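import Mathlib
import Literature.MathematicalPhysics.QuantumLattice.WilsonDiracAP
import Summits.QuantumFields.QCD.Theorems.QuarksAsStableActionCriticalLineDiamagnetismStubCellDetFactorisation
import Summits.QuantumFields.QCD.Theorems.WilsonQuarkChessboardFlatCellOptimalStubFreeDetFormulaAllN
import Summits.QuantumFields.QCD.Theorems.WilsonQuarkChessboardFlatCellOptimalStubCellGainOfGaugedAllN

/-!
# Bloch factorisation of the one-cell antiperiodic determinants, `N` colours
(helper for crux stmt-QuantumFields-9307 `FlatCellOptimal`, line `registered`, stub
`stub_localNormGain_of` (G4 transport), sub-goal `stub_cellDetFactorisationAllN` — the `Fin 3 ↦ Fin N`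
port of the sibling crux stmt-QuantumFields-9734's `…CriticalLineDiamagnetismStubCellDetFactorisation`,
wave 11)

What.  On the even torus `(ℤ/2M)⁴`, for a `U(N)` field `V` (ANY `N : ℕ`), a cell corner `c`, a bare
mass `m`, the central phases `ω = e^{iπ/2M}·1` and `ζ_k(μ) = e^{iπ k_μ/M}·1` (`k ∈ {0,…,M-1}⁴`):
(i) `det D_AP[tile_c V] = ∏_k det D^{(2)}[e ↦ ζ_k(e.2) ω W_c(e)]` and
(ii) `det D_AP[1] = ∏_k det D^{(2)}[e ↦ ζ_k(e.2) ω]`, where `D_AP[X]` is the tree's `r = 1`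
Wilson–Dirac operator of the seam-twisted field (`-X` on the links leaving the slice `val x_μ = 2M - 1`
in direction `μ`), `tile_c V` is the period-2 reflection tiling of the crux and `W_c` is the tiling
read at the representatives `c + a`, `a ∈ {0,1}⁴`, a field on the small torus `(ℤ/2)⁴`
(`stub_cellDetFactorisationAllN`).  The statement is the sibling's `stub_cellDetFactorisation` with
`Fin 3 ↦ Fin N` and with the three `let`s (`dAP` at the fixed mass `m`, `tile`, `Wc`) turned into
universally quantified variables with their defining equations (matched by `fun _ => rfl` from the
skeleton's abbreviations), so that the registered signature contains no `:=`.

How (the sibling's proof, `3 ↦ N`).  (1) SEAM ↔ PHASE for an arbitrary `U(N)` field, already ported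
(`…FlatCellOptimal.FreeBlocks.FreeDetFormula.det_seam_eq_det_phase_mul`): `det D_AP[X] = det D[ω • X]`.
(2) TRANSLATION (`det_wilsonDirac_translate`, from the tree's
`fermionDet_wilsonDirac_torusConfigShift`): `det D[U] = det D[e ↦ U(e.1 + c, e.2)]`.
(3) PERIODICITY (`tile_congr`, even side, any group): a tiled field only depends, on the edge
`(x, μ)`, on the parities `val (x_ν - c_ν) mod 2`, hence `ω · T(x + c, μ) = ω · W_c(x mod 2, μ)`
(`phase_tile_translate_eq`; the `N`-free parity bookkeeping `parity_translate_eq_parity_rep` of the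
sibling file is re-exported, not restated).
(4) The landed, already `N`-generic Bloch–Floquet factorisation `stub_blochFactorisation` of
period-2 fields.  Part (ii) is (1) with `X = 1` and (4) for the constant cell field `ω`.
References: Bloch–Floquet reduction (folklore); Montvay–Münster, *Quantum Fields on a Lattice* §4.2.4
(antiperiodic Wilson fermions as constant `U(1)` phases), §5.1.1 (5.3)–(5.5) (gauge invariance of the
quark determinant).  Pure theorem file (no `def`s).
-/

noncomputable section

open scoped BigOperators Classical Matrix ComplexConjugate
open Finset
open Literature.MathematicalPhysics.QuantumLattice Literature.MathematicalPhysics.QuantumFieldTheory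
  Literature.Probability.LatticeModels

namespace Summit.QuantumFields.QCD.Cruxes.FlatCellOptimal.CellDet

open Summit.QuantumFields.QCD.Cruxes.FlatCellOptimal.FreeBlocks
open Summit.QuantumFields.QCD.Cruxes.FlatCellOptimal.CellGain
open Summit.QuantumFields.QCD.Cruxes.CriticalLineDiamagnetism.ChessboardCellGain (stub_blochFactorisation)

namespace CellDetFactorisation

/-! ### `N`-free bookkeeping of the sibling file, re-exported (alias) -/

export Summit.QuantumFields.QCD.Cruxes.CriticalLineDiamagnetism.ChessboardCellGain.CellDetFactorisation
  (parity_translate_eq_parity_rep)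

variable {N L : ℕ}

/-! ### Translations and the period-2 structure of the tiling -/

/-- **Translation invariance** (`N` colours): `det D[e ↦ U(e.1 + v, e.2)] = det D[U]`
(the tree's `fermionDet_wilsonDirac_torusConfigShift` at `-v`). -/
theorem det_wilsonDirac_translate [NeZero L] (U : GaugeConfig 4 L (Matrix.unitaryGroup (Fin N) ℂ))
    (v : Site 4 L) (m : ℝ) :
    (wilsonDirac (unitaryFundamentalRep (Fin N) ℂ) (fun e : Edge 4 L => U (e.1 + v, e.2)) m 1).det =
      (wilsonDirac (unitaryFundamentalRep (Fin N) ℂ) U m 1).det := by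
  -- adapted from `CellDetFactorisation.det_wilsonDirac_translate` (stmt-QuantumFields-9734; `3 ↦ N`)
  have h : (fun e : Edge 4 L => U (e.1 + v, e.2)) = torusConfigShift (-v) U := by
    funext e
    rw [torusConfigShift_apply, sub_neg_eq_add]
  rw [h]
  exact fermionDet_wilsonDirac_torusConfigShift _ (-v) U m 1

section Period

variable {G : Type*} [Group G]

/-- **Period-2 structure of the reflection tiling** (even `L`, any group): a field `T` satisfying the
defining equation of `tile_c V` only depends, on the edge `(x, μ)`, on the parities
`val (x_ν - c_ν) mod 2` (in the backward branch `val ((x_μ + 1) - c_μ) mod 2` is determined by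
`val (x_μ - c_μ) mod 2` because `L` is even). -/
theorem tile_congr [NeZero L] (hL : Even L) (c : Site 4 L) (V : GaugeConfig 4 L G)
    {T : GaugeConfig 4 L G}
    (hT : ∀ (x : Site 4 L) (μ : Fin 4), T (x, μ) = if (x μ - c μ).val % 2 = 0
        then V (fun ν => c ν + (((x ν - c ν).val % 2 : ℕ) : ZMod L), μ)
        else (V (fun ν => c ν + (((Site.shift x μ ν - c ν).val % 2 : ℕ) : ZMod L), μ))⁻¹)
    {x y : Site 4 L} (μ : Fin 4) (h : ∀ ν, (x ν - c ν).val % 2 = (y ν - c ν).val % 2) :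
    T (x, μ) = T (y, μ) := by
  -- adapted from `CellDetFactorisation.tile_congr` (stmt-QuantumFields-9734; `U(3) ↦` any group)
  have hs : ∀ ν, (Site.shift x μ ν - c ν).val % 2 = (Site.shift y μ ν - c ν).val % 2 := by
    intro ν
    by_cases hν : ν = μ
    · subst hν
      rw [FreeDetFormula.shift_apply_self, FreeDetFormula.shift_apply_self, add_sub_right_comm,
        add_sub_right_comm (y ν), CellGainOfGauged.zmod_val_add_one_mod_two hL,
        CellGainOfGauged.zmod_val_add_one_mod_two hL, Nat.add_mod, h ν, ← Nat.add_mod]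
    · rw [FreeDetFormula.shift_apply_of_ne x hν, FreeDetFormula.shift_apply_of_ne y hν, h ν]
  have h1 : (fun ν => c ν + (((x ν - c ν).val % 2 : ℕ) : ZMod L)) =
      fun ν => c ν + (((y ν - c ν).val % 2 : ℕ) : ZMod L) := funext fun ν => by rw [h ν]
  have h2 : (fun ν => c ν + (((Site.shift x μ ν - c ν).val % 2 : ℕ) : ZMod L)) =
      fun ν => c ν + (((Site.shift y μ ν - c ν).val % 2 : ℕ) : ZMod L) := funext fun ν => by rw [hs ν]
  rw [hT, hT, h μ, h1, h2]

/-- Periodicity of the (left-multiplied) tiling after translation by the corner `c` (any group):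
`ω · T(x + c, μ) = ω · T(c + a(x), μ)` with `a(x)_ν = val x_ν mod 2` read in `ℤ/2` and lifted to
`ℤ/2M`; the right-hand side is the period-2 extension of the cell field `e ↦ ω · T(c + e.1, e.2)`. -/
theorem phase_tile_translate_eq {M : ℕ} [NeZero M] (V : GaugeConfig 4 (2 * M) G) (c : Site 4 (2 * M))
    (ω : G) {T : GaugeConfig 4 (2 * M) G}
    (hT : ∀ (x : Site 4 (2 * M)) (μ : Fin 4), T (x, μ) = if (x μ - c μ).val % 2 = 0
        then V (fun ν => c ν + (((x ν - c ν).val % 2 : ℕ) : ZMod (2 * M)), μ)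
        else (V (fun ν => c ν + (((Site.shift x μ ν - c ν).val % 2 : ℕ) : ZMod (2 * M)), μ))⁻¹) :
    (fun e : Edge 4 (2 * M) => ω * T (e.1 + c, e.2)) = fun e : Edge 4 (2 * M) =>
      ω * T (fun ν => c ν + ((((((e.1 ν).val : ℕ) : ZMod 2)).val : ℕ) : ZMod (2 * M)), e.2) := by
  -- adapted from `CellDetFactorisation.phase_tile_translate_eq` (stmt-QuantumFields-9734; any group)
  funext ⟨x, μ⟩
  show ω * T (x + c, μ) = ω * T (fun ν => c ν + ((((((x ν).val : ℕ) : ZMod 2)).val : ℕ) : ZMod (2 * M)), μ)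
  rw [tile_congr (even_two_mul M) c V hT μ (parity_translate_eq_parity_rep c x)]

end Period

/-! ### The two factorisations, for a tiled field `T` given by its defining equation -/

/-- **Part (i) for a tiled field** (`N` colours).  If `T` satisfies the defining equation of
`tile_c V`, then `det D_AP[T] = ∏_k det D^{(2)}[e ↦ ζ_k(e.2) ω T(c + e.1, e.2)]`: seam ↔ phase,
translation by `c`, periodicity, and the Bloch–Floquet factorisation `stub_blochFactorisation` of the
period-2 field. -/
theorem det_seam_tile_eq {M : ℕ} [NeZero M] (m : ℝ)
    (V : GaugeConfig 4 (2 * M) (Matrix.unitaryGroup (Fin N) ℂ)) (c : Site 4 (2 * M))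
    {ω : Matrix.unitaryGroup (Fin N) ℂ}
    (hω : (ω : Matrix (Fin N) (Fin N) ℂ) =
      Complex.exp (↑(Real.pi / (2 * M : ℕ)) * Complex.I) • (1 : Matrix (Fin N) (Fin N) ℂ))
    (ζ : (Fin 4 → Fin M) → Fin 4 → Matrix.unitaryGroup (Fin N) ℂ)
    (hζ : ∀ k μ, ((ζ k μ : Matrix.unitaryGroup (Fin N) ℂ) : Matrix (Fin N) (Fin N) ℂ) =
      Complex.exp (Real.pi * Complex.I * ((k μ : ℕ) : ℂ) / (M : ℂ)) • (1 : Matrix (Fin N) (Fin N) ℂ))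
    (T : GaugeConfig 4 (2 * M) (Matrix.unitaryGroup (Fin N) ℂ))
    (hT : ∀ (x : Site 4 (2 * M)) (μ : Fin 4), T (x, μ) = if (x μ - c μ).val % 2 = 0
        then V (fun ν => c ν + (((x ν - c ν).val % 2 : ℕ) : ZMod (2 * M)), μ)
        else (V (fun ν => c ν + (((Site.shift x μ ν - c ν).val % 2 : ℕ) : ZMod (2 * M)), μ))⁻¹) :
    (wilsonDirac (unitaryFundamentalRep (Fin N) ℂ)
        (fun e : Edge 4 (2 * M) => if (e.1 e.2).val + 1 = 2 * M then -T e else T e) m 1).det =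
      ∏ k : Fin 4 → Fin M, (wilsonDirac (unitaryFundamentalRep (Fin N) ℂ)
        (fun e : Edge 4 2 => ζ k e.2 * ω * T (fun ν => c ν + (((e.1 ν).val : ℕ) : ZMod (2 * M)), e.2)) m 1).det :=
  -- adapted from `CellDetFactorisation.det_seam_tile_eq` (stmt-QuantumFields-9734; `3 ↦ N`)
  calc (wilsonDirac (unitaryFundamentalRep (Fin N) ℂ)
          (fun e : Edge 4 (2 * M) => if (e.1 e.2).val + 1 = 2 * M then -T e else T e) m 1).det
      = (wilsonDirac (unitaryFundamentalRep (Fin N) ℂ) (fun e : Edge 4 (2 * M) => ω * T e) m 1).det :=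
        FreeDetFormula.det_seam_eq_det_phase_mul m hω T
    _ = (wilsonDirac (unitaryFundamentalRep (Fin N) ℂ)
          (fun e : Edge 4 (2 * M) => ω * T (e.1 + c, e.2)) m 1).det :=
        (det_wilsonDirac_translate (fun e : Edge 4 (2 * M) => ω * T e) c m).symm
    _ = (wilsonDirac (unitaryFundamentalRep (Fin N) ℂ) (fun e : Edge 4 (2 * M) =>
          ω * T (fun ν => c ν + ((((((e.1 ν).val : ℕ) : ZMod 2)).val : ℕ) : ZMod (2 * M)), e.2)) m 1).det := by
        rw [phase_tile_translate_eq V c ω hT]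
    _ = ∏ k : Fin 4 → Fin M, (wilsonDirac (unitaryFundamentalRep (Fin N) ℂ) (fun e : Edge 4 2 =>
          ζ k e.2 * (ω * T (fun ν => c ν + (((e.1 ν).val : ℕ) : ZMod (2 * M)), e.2))) m 1).det :=
        stub_blochFactorisation N M m 1
          (fun e : Edge 4 2 => ω * T (fun ν => c ν + (((e.1 ν).val : ℕ) : ZMod (2 * M)), e.2)) ζ hζ
    _ = ∏ k : Fin 4 → Fin M, (wilsonDirac (unitaryFundamentalRep (Fin N) ℂ) (fun e : Edge 4 2 =>
          ζ k e.2 * ω * T (fun ν => c ν + (((e.1 ν).val : ℕ) : ZMod (2 * M)), e.2)) m 1).det := by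
        simp only [mul_assoc]

/-- **Part (ii)** (`N` colours).  `det D_AP[1] = ∏_k det D^{(2)}[e ↦ ζ_k(e.2) ω]`: seam ↔ phase with
`X = 1`, then the Bloch–Floquet factorisation of the constant field `ω`. -/
theorem det_seam_one_eq {M : ℕ} [NeZero M] (m : ℝ) {ω : Matrix.unitaryGroup (Fin N) ℂ}
    (hω : (ω : Matrix (Fin N) (Fin N) ℂ) =
      Complex.exp (↑(Real.pi / (2 * M : ℕ)) * Complex.I) • (1 : Matrix (Fin N) (Fin N) ℂ))
    (ζ : (Fin 4 → Fin M) → Fin 4 → Matrix.unitaryGroup (Fin N) ℂ)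
    (hζ : ∀ k μ, ((ζ k μ : Matrix.unitaryGroup (Fin N) ℂ) : Matrix (Fin N) (Fin N) ℂ) =
      Complex.exp (Real.pi * Complex.I * ((k μ : ℕ) : ℂ) / (M : ℂ)) • (1 : Matrix (Fin N) (Fin N) ℂ)) :
    (wilsonDirac (unitaryFundamentalRep (Fin N) ℂ)
        (fun e : Edge 4 (2 * M) => if (e.1 e.2).val + 1 = 2 * M
          then -(1 : GaugeConfig 4 (2 * M) (Matrix.unitaryGroup (Fin N) ℂ)) e
          else (1 : GaugeConfig 4 (2 * M) (Matrix.unitaryGroup (Fin N) ℂ)) e) m 1).det =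
      ∏ k : Fin 4 → Fin M,
        (wilsonDirac (unitaryFundamentalRep (Fin N) ℂ) (fun e : Edge 4 2 => ζ k e.2 * ω) m 1).det := by
  -- adapted from `CellDetFactorisation.det_seam_one_eq` (stmt-QuantumFields-9734; `3 ↦ N`)
  have h1 := FreeDetFormula.det_seam_eq_det_phase_mul m hω
    (1 : GaugeConfig 4 (2 * M) (Matrix.unitaryGroup (Fin N) ℂ))
  simp only [Pi.one_apply, mul_one] at h1
  exact h1.trans (stub_blochFactorisation N M m 1 (fun _ : Edge 4 2 => ω) ζ hζ)

end CellDetFactorisation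

/-- **Sub-goal `stub_cellDetFactorisationAllN` (G4 port, wave 11) — Bloch factorisation of the one-cell
antiperiodic determinants, `N` colours.**  On the even torus `(ℤ/2M)⁴`, with `ω = e^{iπ/2M}·1` and
`ζ_k(μ) = e^{iπk_μ/M}·1` in `U(N)`, for `dAP` (at the mass `m`), `tile` and the cell field `Wc` of
`tile c V` given by their defining equations:
(i) `dAP (tile c V) = ∏_{k ∈ {0,…,M-1}⁴} det D^{(2)}[e ↦ ζ_k(e.2) ω Wc(e)]`;
(ii) `dAP 1 = ∏_k det D^{(2)}[e ↦ ζ_k(e.2) ω]`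
(`CellDetFactorisation.det_seam_tile_eq`, `CellDetFactorisation.det_seam_one_eq`). -/
theorem stub_cellDetFactorisationAllN : ∀ (N M : ℕ) [NeZero M] (m : ℝ) (dAP : GaugeConfig 4 (2 * M) (Matrix.unitaryGroup (Fin N) ℂ) → ℂ) (tile : Site 4 (2 * M) → GaugeConfig 4 (2 * M) (Matrix.unitaryGroup (Fin N) ℂ) → GaugeConfig 4 (2 * M) (Matrix.unitaryGroup (Fin N) ℂ)), (∀ X, dAP X = (wilsonDirac (unitaryFundamentalRep (Fin N) ℂ) (fun e => if (e.1 e.2).val + 1 = 2 * M then -X e else X e) m 1).det) → (∀ (c : Site 4 (2 * M)) (V : GaugeConfig 4 (2 * M) (Matrix.unitaryGroup (Fin N) ℂ)) (e : Edge 4 (2 * M)), tile c V e = if (e.1 e.2 - c e.2).val % 2 = 0 then V (fun ν => c ν + (((e.1 ν - c ν).val % 2 : ℕ) : ZMod (2 * M)), e.2) else (V (fun ν => c ν + (((Site.shift e.1 e.2 ν - c ν).val % 2 : ℕ) : ZMod (2 * M)), e.2))⁻¹) → ∀ (V : GaugeConfig 4 (2 * M) (Matrix.unitaryGroup (Fin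 N) ℂ)) (c : Site 4 (2 * M)) (ω : Matrix.unitaryGroup (Fin N) ℂ) (ζ : (Fin 4 → Fin M) → Fin 4 → Matrix.unitaryGroup (Fin N) ℂ), ((ω : Matrix.unitaryGroup (Fin N) ℂ) : Matrix (Fin N) (Fin N) ℂ) = Complex.exp (↑(Real.pi / (2 * M : ℕ)) * Complex.I) • (1 : Matrix (Fin N) (Fin N) ℂ) → (∀ k μ, ((ζ k μ : Matrix.unitaryGroup (Fin N) ℂ) : Matrix (Fin N) (Fin N) ℂ) = Complex.exp (Real.pi * Complex.I * ((k μ : ℕ) : ℂ) / (M : ℂ)) • (1 : Matrix (Fin N) (Fin N) ℂ)) → ∀ (Wc : GaugeConfig 4 2 (Matrix.unitaryGroup (Fin N) ℂ)), (∀ e : Edge 4 2, Wc e = tile c V (fun ν => c ν + (((e.1 ν).val : ℕ) : ZMod (2 * M)), e.2)) → dAP (tile c V) = ∏ k : Fin 4 → Fin M, (wilsonDirac (unitaryFundamentalRep (Fin N) ℂ) (fun e : Edge 4 2 => ζ k e.2 * ω * Wc e) m 1).det ∧ dAP 1 = ∏ k : Fin 4 → Fin M, (wilsonDirac (unitaryFundamentalRep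 (Fin N) ℂ) (fun e : Edge 4 2 => ζ k e.2 * ω) m 1).det := by
  intro N M _ m dAP tile hdAP htile V c ω ζ hω hζ Wc hWc
  have hW : Wc = fun e : Edge 4 2 => tile c V (fun ν => c ν + (((e.1 ν).val : ℕ) : ZMod (2 * M)), e.2) :=
    funext hWc
  refine ⟨?_, ?_⟩
  · rw [hdAP, hW]
    exact CellDetFactorisation.det_seam_tile_eq m V c hω ζ hζ (tile c V) (fun x μ => htile c V (x, μ))
  · rw [hdAP]
    exact CellDetFactorisation.det_seam_one_eq m hω ζ hζ

end Summit.QuantumFields.QCD.Cruxes.FlatCellOptimal.CellDet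

end
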